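import Mathlib
import HarnessLib
import Literature.Analysis.FluidPDE.TypeIAncientMild
import Literature.Analysis.FluidPDE.OseenSlice
import Literature.Analysis.FluidPDE.UlocKernelEstimates
import Literature.Analysis.FluidPDE.LerayVolterraComparison
import Literature.Analysis.FluidPDE.OseenDuhamelPairCalculus
import Summits.NavierStokesRegularity.NavierStokesRegularity.Theorems.QuarterLogPincerTruncationEdgeDefs
import Summits.NavierStokesRegularity.NavierStokesRegularity.Theorems.QuarterLogPincerTypeIQuantSubcubicExpFrameTools
import Summits.NavierStokesRegularity.NavierStokesRegularity.Theorems.QuarterLogPincerQuietCoreDefs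
import Summits.NavierStokesRegularity.NavierStokesRegularity.Theorems.QuarterLogPincerQuietCoreRecessionLaw

/-!
# Route `QuarterLogPincer`, crux `TypeIQuantSubcubicExp` (stmt-NavierStokesRegularity-24077), line `quiet_core` —
# §1d part 2 (PROVED in-file v1.4; ported VERBATIM): T1 — the far-kick integral against the log-corrected recession law

`recessRate_ge_floor`, `far_pointwise_le`, `two_add_posLog_le`, `continuousOn_farKick`, ★ `farKick_integral_le`.
HONEST FRAME: estimates about HYPOTHETICAL Type-I ancient mild fields; nothing here bears on 24077, W7 or Navier–Stokes
regularity (OPEN).  Port by the pub-ns-dss typer (g36), DIRECTOR-NS KEY-NS #181/#182; bodies VERBATIM from tree `Lines/quiet_core.lean`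
v1.5 (sha12 d1a96bf31391, ns-idea-7 g10; critic of record idea-crit-4 g6); docstrings added where the line had none.
-/

noncomputable section

set_option linter.dupNamespace false

namespace Summit.NavierStokesRegularity.NavierStokesRegularity.Cruxes.TypeIQuantSubcubicExp.QuietCore

open MeasureTheory Set Function Metric Filter Topology
open scoped ENNReal NNReal
open Literature.Analysis Literature.Analysis.FluidPDE
open Summit.NavierStokesRegularity.NavierStokesRegularity.Cruxes.TypeIQuantSubcubicExp.TruncationEdge

section RecessionLaw
open Real

/-! #### T1, the far-kick integral against the log-corrected recession law -/

/-- Floor for the recession rate on the near range `a < u ≤ min(2a, b)`: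
`φ(u) ≥ κ b^{3/8} a^{-7/8} Λ/4`, `Λ = c₁ + log(b/a)`, when `c₁ ≥ 2`. -/
theorem recessRate_ge_floor {κ b c₁ a u : ℝ} (hκ : 0 < κ) (hb : 0 < b) (hc₁ : 2 ≤ c₁) (ha : 0 < a) (hab : a ≤ b)
    (hau : a < u) (hu2 : u ≤ 2 * a) :
    κ * b ^ (3 / 8 : ℝ) * a ^ (-(7 / 8 : ℝ)) * (c₁ + Real.log (b / a)) / 4 ≤ recessRate κ b c₁ u := by
  have hu : 0 < u := ha.trans hau
  have hb38 : 0 < b ^ (3 / 8 : ℝ) := Real.rpow_pos_of_pos hb _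
  -- first factor: `u^{-7/8} ≥ (2a)^{-7/8} = 2^{-7/8} a^{-7/8} ≥ a^{-7/8}/2`
  have hpow1 : (2 * a) ^ (-(7 / 8 : ℝ)) ≤ u ^ (-(7 / 8 : ℝ)) :=
    Real.rpow_le_rpow_of_nonpos hu hu2 (by norm_num)
  have hpow2 : a ^ (-(7 / 8 : ℝ)) / 2 ≤ (2 * a) ^ (-(7 / 8 : ℝ)) := by
    rw [Real.mul_rpow (by norm_num) ha.le]
    have h2 : (1 / 2 : ℝ) ≤ (2 : ℝ) ^ (-(7 / 8 : ℝ)) := by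
      rw [show (1 / 2 : ℝ) = (2 : ℝ) ^ (-(1 : ℝ)) by rw [Real.rpow_neg_one]; norm_num]
      exact Real.rpow_le_rpow_of_exponent_le (by norm_num) (by norm_num)
    have ha78 : 0 ≤ a ^ (-(7 / 8 : ℝ)) := Real.rpow_nonneg ha.le _
    calc a ^ (-(7 / 8 : ℝ)) / 2 = (1 / 2) * a ^ (-(7 / 8 : ℝ)) := by ring
      _ ≤ (2 : ℝ) ^ (-(7 / 8 : ℝ)) * a ^ (-(7 / 8 : ℝ)) := mul_le_mul_of_nonneg_right h2 ha78
  -- second factor: `c₁ + log(b/u) ≥ c₁ + log(b/a) − log 2 ≥ Λ/2`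
  have hlogba : 0 ≤ Real.log (b / a) := Real.log_nonneg (by rw [le_div_iff₀ ha, one_mul]; exact hab)
  have hlog1 : Real.log (b / a) - Real.log 2 ≤ Real.log (b / u) := by
    rw [← Real.log_div (div_pos hb ha).ne' (by norm_num)]
    refine Real.log_le_log (by positivity) ?_
    rw [div_div, div_le_div_iff_of_pos_left hb (by positivity) hu]
    linarith
  have hΛ : (c₁ + Real.log (b / a)) / 2 ≤ c₁ + Real.log (b / u) := by
    have : Real.log 2 ≤ 1 := by have := Real.log_two_lt_d9; linarith  -- (line's `log_two_le_one`, a dedup of a tree lemma)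
    linarith
  have hΛnn : 0 ≤ (c₁ + Real.log (b / a)) / 2 := by linarith
  unfold recessRate
  have hA : 0 ≤ κ * b ^ (3 / 8 : ℝ) := by positivity
  calc κ * b ^ (3 / 8 : ℝ) * a ^ (-(7 / 8 : ℝ)) * (c₁ + Real.log (b / a)) / 4
      = κ * b ^ (3 / 8 : ℝ) * (a ^ (-(7 / 8 : ℝ)) / 2) * ((c₁ + Real.log (b / a)) / 2) := by ring
    _ ≤ κ * b ^ (3 / 8 : ℝ) * u ^ (-(7 / 8 : ℝ)) * (c₁ + Real.log (b / u)) := by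
        apply mul_le_mul (mul_le_mul_of_nonneg_left (hpow2.trans hpow1) hA) hΛ hΛnn
        exact mul_nonneg hA (Real.rpow_nonneg hu.le _)

/-- Far-range pointwise bound: for `2a ≤ u ≤ b` (`0 < a`, `c₁ > 0`),
`u⁻¹ · 4π/(Φ(u) − Φ(a)) ≤ (8π/(κ b^{3/8} c₁)) · u^{-9/8}`. -/
theorem far_pointwise_le {κ b c₁ a u : ℝ} (hκ : 0 < κ) (hb : 0 < b) (hc₁ : 0 < c₁) (ha : 0 < a)
    (hu2 : 2 * a ≤ u) (hub : u ≤ b) :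
    u⁻¹ * (4 * π / (recessPhi κ b c₁ u - recessPhi κ b c₁ a)) ≤
      8 * π / (κ * b ^ (3 / 8 : ℝ) * c₁) * u ^ (-(9 / 8 : ℝ)) := by
  have hau : a < u := by linarith
  have hu : 0 < u := ha.trans hau
  have hb38 : 0 < b ^ (3 / 8 : ℝ) := Real.rpow_pos_of_pos hb _
  have hu78 : 0 < u ^ (-(7 / 8 : ℝ)) := Real.rpow_pos_of_pos hu _
  -- `Φ(u) − Φ(a) ≥ φ(u)(u − a) ≥ κ b^{3/8} u^{-7/8} c₁ · (u/2)`
  have hmvt := recessRate_mul_sub_le hκ hb hc₁ ha hau hub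
  have hlog : 0 ≤ Real.log (b / u) := Real.log_nonneg (by rw [le_div_iff₀ hu, one_mul]; exact hub)
  have hrate : κ * b ^ (3 / 8 : ℝ) * u ^ (-(7 / 8 : ℝ)) * c₁ ≤ recessRate κ b c₁ u := by
    unfold recessRate
    have hA : 0 ≤ κ * b ^ (3 / 8 : ℝ) * u ^ (-(7 / 8 : ℝ)) := by positivity
    exact mul_le_mul_of_nonneg_left (by linarith) hA
  have hD : κ * b ^ (3 / 8 : ℝ) * u ^ (-(7 / 8 : ℝ)) * c₁ * (u / 2) ≤
      recessPhi κ b c₁ u - recessPhi κ b c₁ a := by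
    have h1 : κ * b ^ (3 / 8 : ℝ) * u ^ (-(7 / 8 : ℝ)) * c₁ * (u / 2) ≤ recessRate κ b c₁ u * (u - a) := by
      apply mul_le_mul hrate (by linarith) (by linarith)
      exact (recessRate_pos hκ hb hc₁ hu hub).le
    exact h1.trans hmvt
  have hDpos : 0 < κ * b ^ (3 / 8 : ℝ) * u ^ (-(7 / 8 : ℝ)) * c₁ * (u / 2) := by positivity
  -- hence `4π/(Φu − Φa) ≤ 4π / (κ b^{3/8} u^{-7/8} c₁ u/2)`
  have hfrac : 4 * π / (recessPhi κ b c₁ u - recessPhi κ b c₁ a) ≤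
      4 * π / (κ * b ^ (3 / 8 : ℝ) * u ^ (-(7 / 8 : ℝ)) * c₁ * (u / 2)) :=
    div_le_div_of_nonneg_left (by positivity) hDpos hD
  have hupow : u ^ (-(9 / 8 : ℝ)) = u⁻¹ * u⁻¹ * (u ^ (-(7 / 8 : ℝ)))⁻¹ := by
    rw [Real.rpow_neg hu.le (7 / 8 : ℝ), inv_inv, ← Real.rpow_neg_one, ← Real.rpow_add hu, ← Real.rpow_add hu]
    norm_num
  set w : ℝ := u ^ (-(7 / 8 : ℝ)) with hw
  have hwne : w ≠ 0 := hu78.ne'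
  calc u⁻¹ * (4 * π / (recessPhi κ b c₁ u - recessPhi κ b c₁ a))
      ≤ u⁻¹ * (4 * π / (κ * b ^ (3 / 8 : ℝ) * w * c₁ * (u / 2))) :=
        mul_le_mul_of_nonneg_left hfrac (inv_nonneg.2 hu.le)
    _ = 8 * π / (κ * b ^ (3 / 8 : ℝ) * c₁) * (u⁻¹ * u⁻¹ * w⁻¹) := by
        field_simp; norm_num
    _ = 8 * π / (κ * b ^ (3 / 8 : ℝ) * c₁) * u ^ (-(9 / 8 : ℝ)) := by rw [hupow]

/-- The logarithmic bookkeeping: if `2 ≤ Λ`, `1 ≤ r`, `log r ≤ Λ`, `2|log κ| + |log X| ≤ Λ − 2` and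
`0 < y ≤ κ² r Λ² X`, then `2 + log⁺ y ≤ 4Λ`. -/
theorem two_add_posLog_le {κ X Λ r y : ℝ} (hκ : 0 < κ) (hX : 0 < X) (hΛ : 2 ≤ Λ) (hr : 1 ≤ r)
    (hrΛ : Real.log r ≤ Λ) (hc : 2 * |Real.log κ| + |Real.log X| ≤ Λ - 2) (hy0 : 0 < y)
    (hy : y ≤ κ ^ 2 * r * Λ ^ 2 * X) : 2 + max 0 (Real.log y) ≤ 4 * Λ := by
  have hΛpos : 0 < Λ := by linarith
  have hlogy : Real.log y ≤ 2 * Real.log κ + Real.log r + 2 * Real.log Λ + Real.log X := by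
    have h := Real.log_le_log hy0 hy
    rw [Real.log_mul (by positivity) hX.ne', Real.log_mul (by positivity) (by positivity),
      Real.log_mul (by positivity) (by positivity), Real.log_pow, Real.log_pow] at h
    push_cast at h
    linarith
  have hlogΛ : Real.log Λ ≤ Λ - 1 := Real.log_le_sub_one_of_pos hΛpos
  have h1 : Real.log κ ≤ |Real.log κ| := le_abs_self _
  have h2 : Real.log X ≤ |Real.log X| := le_abs_self _
  have hly : Real.log y ≤ 4 * Λ - 4 := by linarith
  rcases le_total 0 (Real.log y) with h | h
  · rw [max_eq_right h]; linarith
  · rw [max_eq_left h]; linarith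


/-- The far-kick integrand `g(u) = u⁻¹ · min(I(u−a)^{-1/2}, 4π/(Φ(u) − Φ(a)))` is continuous on `(a, b]`. -/
theorem continuousOn_farKick {κ b c₁ a I : ℝ} (hκ : 0 < κ) (hb : 0 < b) (hc₁ : 0 < c₁) (ha : 0 < a) :
    ContinuousOn (fun u : ℝ => u⁻¹ * min (I * (u - a) ^ (-(1 / 2 : ℝ)))
      (4 * π / (recessPhi κ b c₁ u - recessPhi κ b c₁ a))) (Ioc a b) := by
  have hc0 : ContinuousOn (fun u : ℝ => u⁻¹) (Ioc a b) :=
    (continuousOn_inv₀ (G₀ := ℝ)).mono fun u hu => (ha.trans hu.1).ne'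
  have hc1 : ContinuousOn (fun u : ℝ => I * (u - a) ^ (-(1 / 2 : ℝ))) (Ioc a b) := by
    refine continuousOn_const.mul ?_
    exact ContinuousOn.rpow_const (continuousOn_id.sub continuousOn_const)
      (fun u hu => Or.inl (sub_ne_zero.2 (ne_of_gt hu.1)))
  have hc2 : ContinuousOn (fun u : ℝ => 4 * π / (recessPhi κ b c₁ u - recessPhi κ b c₁ a)) (Ioc a b) := by
    refine continuousOn_const.div (((continuousOn_recessPhi hb).mono ?_).sub continuousOn_const) ?_
    · exact fun u hu => ha.trans hu.1
    · intro u hu; exact (sub_pos.2 (recessPhi_lt hκ hb hc₁ ha hu.1 hu.2)).ne'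
  exact hc0.mul (continuous_min.comp_continuousOn (hc1.prodMk hc2))

/-- **T1 (far-kick calculus for the log-corrected recession law).**
For `0 < a < b`, `κ, I > 0` and `c₁ ≥ 2 + 2|log κ| + |log(I²/(16π²))|`, with
`Φ(u) = 8κ b^{3/8} u^{1/8}(c₁ + 8 + log(b/u))`:
`∫_a^b u⁻¹ · min(I (u−a)^{-1/2}, 4π/(Φ(u) − Φ(a))) du ≤ (96π/κ) · b^{-3/8} · a^{-1/8}`.
(In the S3♭ bootstrap: `u = −τ`, `a = −t`, `b = −s`; the Type-I far field outside the receding ball `B(0, 3/4 + Φ(−τ))`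
kicks the point `x`, `‖x‖ < 3/4 + Φ(−t)`, at rate `C M² u⁻¹ min(I σ^{-1/2}, 4π/d)` by `norm_oseenSlice_receding`; choosing
`κ = 96π C M²/c₀` makes the total far kick `≤ c₀ b^{-3/8} a^{-1/8}`, a quarter of the target `4c₀ b^{-3/8} a^{-1/8}`.) -/
theorem farKick_integral_le {κ b c₁ a I : ℝ} (hκ : 0 < κ) (hI : 0 < I) (ha : 0 < a) (hab : a < b)
    (hc₁ : 2 + 2 * |Real.log κ| + |Real.log (I ^ 2 / (16 * π ^ 2))| ≤ c₁) :
    ∫ u in a..b, u⁻¹ * min (I * (u - a) ^ (-(1 / 2 : ℝ))) (4 * π / (recessPhi κ b c₁ u - recessPhi κ b c₁ a)) ≤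
      96 * π / κ * b ^ (-(3 / 8 : ℝ)) * a ^ (-(1 / 8 : ℝ)) := by
  have hb : 0 < b := ha.trans hab
  have hc₁2 : 2 ≤ c₁ := by
    have h1 := abs_nonneg (Real.log κ); have h2 := abs_nonneg (Real.log (I ^ 2 / (16 * π ^ 2))); linarith
  have hc₁pos : 0 < c₁ := by linarith
  set Φ : ℝ → ℝ := recessPhi κ b c₁ with hΦ
  set g : ℝ → ℝ := fun u => u⁻¹ * min (I * (u - a) ^ (-(1 / 2 : ℝ))) (4 * π / (Φ u - Φ a)) with hg
  -- the split point `a₂ = min(2a, b)` and the near-range length `ℓ = a₂ − a ∈ (0, a]`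
  set a₂ : ℝ := min (2 * a) b with ha₂
  have ha₂a : a < a₂ := lt_min (by linarith) hab
  have ha₂2 : a₂ ≤ 2 * a := min_le_left _ _
  have ha₂b : a₂ ≤ b := min_le_right _ _
  set ℓ : ℝ := a₂ - a with hℓ
  have hℓpos : 0 < ℓ := by rw [hℓ]; linarith
  have hℓa : ℓ ≤ a := by rw [hℓ]; linarith
  have haℓ : a + ℓ = a₂ := by rw [hℓ]; ring
  -- `Λ` and the rate floor `φ⋆`
  set Λ : ℝ := c₁ + Real.log (b / a) with hΛ
  have hlogba : 0 ≤ Real.log (b / a) := Real.log_nonneg (by rw [le_div_iff₀ ha, one_mul]; exact hab.le)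
  have hΛc : c₁ ≤ Λ := by rw [hΛ]; linarith
  have hΛ2 : 2 ≤ Λ := hc₁2.trans hΛc
  have hΛpos : 0 < Λ := by linarith
  have hb38 : 0 < b ^ (3 / 8 : ℝ) := Real.rpow_pos_of_pos hb _
  have ha78 : 0 < a ^ (-(7 / 8 : ℝ)) := Real.rpow_pos_of_pos ha _
  set φs : ℝ := κ * b ^ (3 / 8 : ℝ) * a ^ (-(7 / 8 : ℝ)) * Λ / 4 with hφs
  have hφs_pos : 0 < φs := by rw [hφs]; positivity
  -- nonnegativity and the two pointwise majorants
  have hgnn : ∀ u, a < u → u ≤ b → 0 ≤ g u := by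
    intro u hau hub
    have hu : 0 < u := ha.trans hau
    have hd : 0 < Φ u - Φ a := sub_pos.2 (recessPhi_lt hκ hb hc₁pos ha hau hub)
    rw [hg]
    exact mul_nonneg (inv_nonneg.2 hu.le) (le_min (mul_nonneg hI.le (Real.rpow_nonneg (by linarith) _))
      (div_nonneg (by positivity) hd.le))
  have hnear : ∀ u, a < u → u ≤ a₂ →
      g u ≤ a⁻¹ * min (I * (u - a) ^ (-(1 / 2 : ℝ))) (4 * π / (φs * (u - a))) := by
    intro u hau hua₂
    have hu : 0 < u := ha.trans hau
    have hub : u ≤ b := hua₂.trans ha₂b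
    have hfloor : φs ≤ recessRate κ b c₁ u := by
      rw [hφs, hΛ]; exact recessRate_ge_floor hκ hb hc₁2 ha hab.le hau (hua₂.trans ha₂2)
    have hmvt := recessRate_mul_sub_le hκ hb hc₁pos ha hau hub
    have hd : φs * (u - a) ≤ Φ u - Φ a :=
      (mul_le_mul_of_nonneg_right hfloor (by linarith)).trans hmvt
    have hdpos : 0 < φs * (u - a) := mul_pos hφs_pos (by linarith)
    have hmin : min (I * (u - a) ^ (-(1 / 2 : ℝ))) (4 * π / (Φ u - Φ a)) ≤
        min (I * (u - a) ^ (-(1 / 2 : ℝ))) (4 * π / (φs * (u - a))) :=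
      min_le_min_left _ (div_le_div_of_nonneg_left (by positivity) hdpos hd)
    have hmin_nn : 0 ≤ min (I * (u - a) ^ (-(1 / 2 : ℝ))) (4 * π / (φs * (u - a))) :=
      le_min (mul_nonneg hI.le (Real.rpow_nonneg (by linarith) _)) (div_nonneg (by positivity) hdpos.le)
    rw [hg]
    exact mul_le_mul (inv_anti₀ ha hau.le) hmin
      (le_min (mul_nonneg hI.le (Real.rpow_nonneg (by linarith) _))
        (div_nonneg (by positivity) (hdpos.le.trans hd))) (inv_nonneg.2 ha.le)
  have hfar : ∀ u, 2 * a ≤ u → u ≤ b →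
      g u ≤ 8 * π / (κ * b ^ (3 / 8 : ℝ) * c₁) * u ^ (-(9 / 8 : ℝ)) := by
    intro u hu2 hub
    have hu : 0 < u := by linarith
    have h1 : g u ≤ u⁻¹ * (4 * π / (Φ u - Φ a)) := by
      rw [hg]; exact mul_le_mul_of_nonneg_left (min_le_right _ _) (inv_nonneg.2 hu.le)
    exact h1.trans (far_pointwise_le hκ hb hc₁pos ha hu2 hub)
  -- integrability
  have hgc : ContinuousOn g (Ioc a b) := by rw [hg]; exact continuousOn_farKick hκ hb hc₁pos ha
  have hcross_int : IntervalIntegrable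
      (fun u : ℝ => a⁻¹ * min (I * (u - a) ^ (-(1 / 2 : ℝ))) (4 * π / (φs * (u - a)))) volume a a₂ :=
    (intervalIntegrable_crossMin hI hφs_pos ha₂a.le).const_mul a⁻¹
  have hsq_int : IntervalIntegrable (fun u : ℝ => a⁻¹ * (I * (u - a) ^ (-(1 / 2 : ℝ)))) volume a a₂ := by
    have h0 : IntervalIntegrable (fun x : ℝ => x ^ (-(1 / 2 : ℝ))) volume 0 (a₂ - a) :=
      intervalIntegral.intervalIntegrable_rpow' (by norm_num)
    have h1 := ((h0.comp_sub_right a).const_mul I).const_mul a⁻¹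
    simp only [zero_add, sub_add_cancel] at h1
    exact h1
  have hg_int1 : IntervalIntegrable g volume a a₂ := by
    refine hsq_int.mono_fun' ?_ ?_
    · refine (hgc.mono ?_).aestronglyMeasurable measurableSet_uIoc
      rw [uIoc_of_le ha₂a.le]; exact fun u hu => ⟨hu.1, hu.2.trans ha₂b⟩
    · rw [uIoc_of_le ha₂a.le]
      refine (ae_restrict_mem measurableSet_Ioc).mono fun u hu => ?_
      show ‖g u‖ ≤ a⁻¹ * (I * (u - a) ^ (-(1 / 2 : ℝ)))
      rw [Real.norm_of_nonneg (hgnn u hu.1 (hu.2.trans ha₂b))]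
      exact (hnear u hu.1 hu.2).trans (mul_le_mul_of_nonneg_left (min_le_left _ _) (inv_nonneg.2 ha.le))
  have hg_int2 : IntervalIntegrable g volume a₂ b := by
    refine (hgc.mono ?_).intervalIntegrable
    rw [uIcc_of_le ha₂b]; exact fun u hu => ⟨ha₂a.trans_le hu.1, hu.2⟩
  -- NEAR RANGE
  have hX : 0 < I ^ 2 / (16 * π ^ 2) := by positivity
  have hnear_int : ∫ u in a..a₂, g u ≤ 64 * π / κ * b ^ (-(3 / 8 : ℝ)) * a ^ (-(1 / 8 : ℝ)) := by
    have hmono : ∫ u in a..a₂, g u ≤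
        ∫ u in a..a₂, a⁻¹ * min (I * (u - a) ^ (-(1 / 2 : ℝ))) (4 * π / (φs * (u - a))) :=
      intervalIntegral.integral_mono_on_of_le_Ioo ha₂a.le hg_int1 hcross_int fun u hu => hnear u hu.1 hu.2.le
    refine hmono.trans ?_
    rw [intervalIntegral.integral_const_mul, ← haℓ]
    have hcross := crossover_integral_le hI hφs_pos ha hℓpos hℓa
    -- the logarithm: `2 + log⁺(a I² φ⋆²/(16π²)) ≤ 4Λ`
    have hy0 : 0 < a * (I ^ 2 * φs ^ 2 / (16 * π ^ 2)) := by positivity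
    have hy : a * (I ^ 2 * φs ^ 2 / (16 * π ^ 2)) ≤ κ ^ 2 * (b / a) * Λ ^ 2 * (I ^ 2 / (16 * π ^ 2)) := by
      -- `a φ⋆² = κ² Λ² (b/a)^{3/4}/16 ≤ κ² Λ² (b/a)`
      have hs2 : (b ^ (3 / 8 : ℝ)) ^ 2 = b ^ (3 / 4 : ℝ) := by
        rw [← Real.rpow_natCast, ← Real.rpow_mul hb.le]; norm_num
      have ht2 : (a ^ (-(7 / 8 : ℝ))) ^ 2 = a ^ (-(7 / 4 : ℝ)) := by
        rw [← Real.rpow_natCast, ← Real.rpow_mul ha.le]; norm_num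
      have hat : a * a ^ (-(7 / 4 : ℝ)) = a ^ (-(3 / 4 : ℝ)) := by
        rw [show a * a ^ (-(7 / 4 : ℝ)) = a ^ (1 : ℝ) * a ^ (-(7 / 4 : ℝ)) by rw [Real.rpow_one],
          ← Real.rpow_add ha]; norm_num
      have hquot : b ^ (3 / 4 : ℝ) * a ^ (-(3 / 4 : ℝ)) = (b / a) ^ (3 / 4 : ℝ) := by
        rw [Real.div_rpow hb.le ha.le, Real.rpow_neg ha.le]
        exact (div_eq_mul_inv _ _).symm
      have hle1 : (b / a) ^ (3 / 4 : ℝ) ≤ b / a := by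
        have h1 : 1 ≤ b / a := by rw [le_div_iff₀ ha, one_mul]; exact hab.le
        calc (b / a) ^ (3 / 4 : ℝ) ≤ (b / a) ^ (1 : ℝ) := Real.rpow_le_rpow_of_exponent_le h1 (by norm_num)
          _ = b / a := Real.rpow_one _
      have hmain : a * φs ^ 2 ≤ κ ^ 2 * (b / a) * Λ ^ 2 := by
        have hexp : a * φs ^ 2 = κ ^ 2 * Λ ^ 2 * (b / a) ^ (3 / 4 : ℝ) / 16 := by
          rw [hφs]
          calc a * (κ * b ^ (3 / 8 : ℝ) * a ^ (-(7 / 8 : ℝ)) * Λ / 4) ^ 2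
              = κ ^ 2 * Λ ^ 2 * ((b ^ (3 / 8 : ℝ)) ^ 2 * (a * (a ^ (-(7 / 8 : ℝ))) ^ 2)) / 16 := by ring
            _ = κ ^ 2 * Λ ^ 2 * (b / a) ^ (3 / 4 : ℝ) / 16 := by rw [hs2, ht2, hat, hquot]
        rw [hexp]
        have hK : 0 ≤ κ ^ 2 * Λ ^ 2 := by positivity
        have hq : 0 ≤ (b / a) ^ (3 / 4 : ℝ) := Real.rpow_nonneg (div_pos hb ha).le _
        nlinarith [mul_le_mul_of_nonneg_left hle1 hK]
      have := mul_le_mul_of_nonneg_right hmain hX.le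
      calc a * (I ^ 2 * φs ^ 2 / (16 * π ^ 2)) = a * φs ^ 2 * (I ^ 2 / (16 * π ^ 2)) := by ring
        _ ≤ κ ^ 2 * (b / a) * Λ ^ 2 * (I ^ 2 / (16 * π ^ 2)) := this
    have hlogest : 2 + max 0 (Real.log (a * (I ^ 2 * φs ^ 2 / (16 * π ^ 2)))) ≤ 4 * Λ :=
      two_add_posLog_le hκ hX hΛ2 (by rw [le_div_iff₀ ha, one_mul]; exact hab.le)
        (by rw [hΛ]; linarith) (by linarith) hy0 hy
    have h4φ : 0 ≤ 4 * π / φs := by positivity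
    have hstep : a⁻¹ * ((4 * π / φs) * (2 + max 0 (Real.log (a * (I ^ 2 * φs ^ 2 / (16 * π ^ 2)))))) ≤
        a⁻¹ * ((4 * π / φs) * (4 * Λ)) :=
      mul_le_mul_of_nonneg_left (mul_le_mul_of_nonneg_left hlogest h4φ) (inv_nonneg.2 ha.le)
    refine (mul_le_mul_of_nonneg_left hcross (inv_nonneg.2 ha.le)).trans (hstep.trans (le_of_eq ?_))
    -- algebra: `a⁻¹ · (4π/φ⋆) · 4Λ = (64π/κ) b^{-3/8} a^{-1/8}`
    have hb_neg : b ^ (-(3 / 8 : ℝ)) = (b ^ (3 / 8 : ℝ))⁻¹ := Real.rpow_neg hb.le _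
    have ha_neg : a ^ (-(1 / 8 : ℝ)) = a⁻¹ * (a ^ (-(7 / 8 : ℝ)))⁻¹ := by
      rw [Real.rpow_neg ha.le (7 / 8 : ℝ), inv_inv, ← Real.rpow_neg_one, ← Real.rpow_add ha]; norm_num
    rw [hb_neg, ha_neg, hφs]
    field_simp
    ring
  -- FAR RANGE
  have hfar_int : ∫ u in a₂..b, g u ≤ 32 * π / κ * b ^ (-(3 / 8 : ℝ)) * a ^ (-(1 / 8 : ℝ)) := by
    have hrhs_nn : 0 ≤ 32 * π / κ * b ^ (-(3 / 8 : ℝ)) * a ^ (-(1 / 8 : ℝ)) := by positivity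
    rcases le_or_gt b (2 * a) with h2a | h2a
    · -- `a₂ = b`: empty far range
      have : a₂ = b := by rw [ha₂]; exact min_eq_right h2a
      rw [this, intervalIntegral.integral_same]; exact hrhs_nn
    · have ha₂eq : a₂ = 2 * a := by rw [ha₂]; exact min_eq_left h2a.le
      rw [ha₂eq]
      set K₉ : ℝ := 8 * π / (κ * b ^ (3 / 8 : ℝ) * c₁) with hK₉
      have hK₉nn : 0 ≤ K₉ := by rw [hK₉]; positivity
      have hmaj_cont : ContinuousOn (fun u : ℝ => K₉ * u ^ (-(9 / 8 : ℝ))) (uIcc (2 * a) b) := by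
        refine continuousOn_const.mul (ContinuousOn.rpow_const continuousOn_id fun u hu => Or.inl ?_)
        rw [uIcc_of_le h2a.le] at hu; exact (by linarith [hu.1] : (0 : ℝ) < u).ne'
      have hg_int2' : IntervalIntegrable g volume (2 * a) b := by rw [← ha₂eq]; exact hg_int2
      have hmono : ∫ u in (2 * a)..b, g u ≤ ∫ u in (2 * a)..b, K₉ * u ^ (-(9 / 8 : ℝ)) :=
        intervalIntegral.integral_mono_on h2a.le hg_int2' hmaj_cont.intervalIntegrable
          fun u hu => hfar u hu.1 hu.2
      refine hmono.trans ?_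
      rw [intervalIntegral.integral_const_mul,
        integral_rpow (Or.inr ⟨by norm_num, notMem_uIcc_of_lt (by linarith) hb⟩)]
      have hexp : (-(9 / 8 : ℝ)) + 1 = -(1 / 8 : ℝ) := by norm_num
      rw [hexp]
      -- `K₉ · (b^{-1/8} − (2a)^{-1/8})/(−1/8) = 8 K₉ ((2a)^{-1/8} − b^{-1/8}) ≤ 8 K₉ a^{-1/8}`
      have h2a_le : (2 * a) ^ (-(1 / 8 : ℝ)) ≤ a ^ (-(1 / 8 : ℝ)) :=
        Real.rpow_le_rpow_of_nonpos ha (by linarith) (by norm_num)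
      have hb_nn : 0 ≤ b ^ (-(1 / 8 : ℝ)) := Real.rpow_nonneg hb.le _
      have hval : K₉ * ((b ^ (-(1 / 8 : ℝ)) - (2 * a) ^ (-(1 / 8 : ℝ))) / -(1 / 8 : ℝ)) ≤ 8 * K₉ * a ^ (-(1 / 8 : ℝ)) := by
        have : K₉ * ((b ^ (-(1 / 8 : ℝ)) - (2 * a) ^ (-(1 / 8 : ℝ))) / -(1 / 8 : ℝ)) =
            8 * K₉ * ((2 * a) ^ (-(1 / 8 : ℝ)) - b ^ (-(1 / 8 : ℝ))) := by ring
        rw [this]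
        have h8K : 0 ≤ 8 * K₉ := by positivity
        exact mul_le_mul_of_nonneg_left (by linarith) h8K
      refine hval.trans ?_
      -- `8 K₉ a^{-1/8} = (64π/(κ c₁)) b^{-3/8} a^{-1/8} ≤ (32π/κ) b^{-3/8} a^{-1/8}`
      have hb_neg : b ^ (-(3 / 8 : ℝ)) = (b ^ (3 / 8 : ℝ))⁻¹ := Real.rpow_neg hb.le _
      have ha18 : 0 ≤ a ^ (-(1 / 8 : ℝ)) := Real.rpow_nonneg ha.le _
      have hcoef : 8 * K₉ ≤ 32 * π / κ * b ^ (-(3 / 8 : ℝ)) := by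
        rw [hK₉, hb_neg]
        rw [show 8 * (8 * π / (κ * b ^ (3 / 8 : ℝ) * c₁)) = (64 * π / (κ * b ^ (3 / 8 : ℝ))) * (1 / c₁) by
          field_simp; ring]
        rw [show 32 * π / κ * (b ^ (3 / 8 : ℝ))⁻¹ = (64 * π / (κ * b ^ (3 / 8 : ℝ))) * (1 / 2) by
          field_simp; ring]
        have hpos : 0 ≤ 64 * π / (κ * b ^ (3 / 8 : ℝ)) := by positivity
        exact mul_le_mul_of_nonneg_left (by rw [one_div_le_one_div hc₁pos (by norm_num)]; exact hc₁2) hpos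
      exact mul_le_mul_of_nonneg_right hcoef ha18
  -- SUM
  have hsplit : ∫ u in a..b, g u = (∫ u in a..a₂, g u) + ∫ u in a₂..b, g u :=
    (intervalIntegral.integral_add_adjacent_intervals hg_int1 hg_int2).symm
  show ∫ u in a..b, g u ≤ 96 * π / κ * b ^ (-(3 / 8 : ℝ)) * a ^ (-(1 / 8 : ℝ))
  rw [hsplit]
  calc (∫ u in a..a₂, g u) + ∫ u in a₂..b, g u
      ≤ 64 * π / κ * b ^ (-(3 / 8 : ℝ)) * a ^ (-(1 / 8 : ℝ)) + 32 * π / κ * b ^ (-(3 / 8 : ℝ)) * a ^ (-(1 / 8 : ℝ)) :=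
        add_le_add hnear_int hfar_int
    _ = 96 * π / κ * b ^ (-(3 / 8 : ℝ)) * a ^ (-(1 / 8 : ℝ)) := by ring


end RecessionLaw

end Summit.NavierStokesRegularity.NavierStokesRegularity.Cruxes.TypeIQuantSubcubicExp.QuietCore

end
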